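import Mathlib
import HarnessLib
import Summits.HubbardSuperconductivity.HubbardSuperconductivity.Theorems.DeformationLadderLowEnergyRigidityCompressionGap
import Literature.MathematicalPhysics.QuantumLattice.FermionOperatorsProofs

/-!
# Route `DeformationLadder` — crux `LowEnergyRigidity` (stmt-HubbardSuperconductivity-1892),
# crux idea `heavy-condensate-fibration`: explicit kernel states and the `minEnergyOn` normal form

The condensate-poor part of the sector is never empty: for `δ L ≥ 3` the occupation basis state
with the `↑` electrons on the first `m` sites and the `↓` electrons on `m` sites two rows further
(`m = ⌊(1-δ)L²/2⌋`, sites ranked by `x₀ + L x₁`) lies in `szSector (2m) 0` and is annihilated by the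
`d`-wave pair field, hence by `Π_L = L⁻⁴ Δᴴ Δ` (`hcf_exists_unit_kernel_state`): no `↑` site is
within a lattice step of a `↓` site, so every bond pair `c_{x↑}c_{x+e,↓} - c_{x↓}c_{x+e,↑}` kills it
(`hcf_pairField_mulVec_single_eq_zero`). Consequently the vector form of the compression gap
(`…CompressionGap`) upgrades to the Sketch's `minEnergyOn` form, and the crux gets the literal
normal form of the card (`hcf_compressionGapAt_iff_lowEnergyRigidity`):
`LowEnergyRigidity ↔ ∃ U>0, δ∈(0,½), a>0, κ>0, L₀, ∀ even L ≥ L₀,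
  minEnergyOn H_L S_L + κ ≤ minEnergyOn H_L (S_L ⊓ ⊕_{μ≤a} ker(Π_L - μ))`
(`CompressionGapAt U δ a κ` of `Cruxes/LowEnergyRigidity/SketchIdeator3.lean` §B, with `condPoor`).
-/

namespace Summit.HubbardSuperconductivity.HubbardSuperconductivity.Theorems

set_option linter.dupNamespace false

open Literature.MathematicalPhysics.QuantumLattice Literature.Probability.LatticeModels Matrix Complex Finset
open scoped Matrix.Norms.L2Operator ComplexOrder
open Summit.HubbardSuperconductivity.HubbardSuperconductivity.Theses.DeformationLadder

/-! ### Pair operators on occupation basis states -/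

section Basis

variable {ι : Type*} [LinearOrder ι] [Fintype ι]

/-- `c_i c_j |s₀⟩ = 0` unless both orbitals `i, j` are occupied in `s₀`. [folklore] -/
theorem hcf_annihilation_mul_annihilation_mulVec_single_eq_zero (i j : ι) (s₀ : Finset ι)
    (h : ¬ (i ∈ s₀ ∧ j ∈ s₀)) :
    (annihilation i * annihilation j) *ᵥ Pi.single s₀ (1 : ℂ) = 0 := by
  rw [← mulVec_mulVec, annihilation_mulVec_single]
  split_ifs with hj
  · rw [mulVec_smul, annihilation_mulVec_single, if_neg (fun hi => h ⟨Finset.mem_of_mem_erase hi, hj⟩),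
      smul_zero]
  · rw [mulVec_zero]

end Basis

section Torus

variable (L : ℕ) [NeZero L]

/-- **Basis states without `↑↓` neighbours are annihilated by every pair field**: if no step
`e ∈ {0, ±e₁, ±e₂}` joins an occupied `↑` orbital to an occupied `↓` orbital of `s₀` (in either
order), then `Δ_g |s₀⟩ = 0` for every form factor `g`. [folklore] -/
theorem hcf_pairField_mulVec_single_eq_zero (g : Site 2 → ℝ) (s₀ : Finset (Orb (FermionTorus 2 L)))
    (h : ∀ (x : TorusSite 2 L), ∀ e ∈ insert (0 : Site 2) unitSteps,
      ¬ (orb (FermionTorus.ofTorusSite x) 0 ∈ s₀ ∧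
          orb (FermionTorus.ofTorusSite (x + Torus.proj L e)) 1 ∈ s₀) ∧
      ¬ (orb (FermionTorus.ofTorusSite x) 1 ∈ s₀ ∧
          orb (FermionTorus.ofTorusSite (x + Torus.proj L e)) 0 ∈ s₀)) :
    pairField g L *ᵥ Pi.single s₀ (1 : ℂ) = 0 := by
  rw [pairField, sum_mulVec]
  refine sum_eq_zero fun x _ => ?_
  rw [localPair, sum_mulVec]
  refine sum_eq_zero fun e he => ?_
  rw [smul_mulVec, sub_mulVec]
  -- (`convert` bridges the `DecidableEq` instance chosen for `Pi.single` on the concrete torus)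
  have h1 : (annihilation (orb (FermionTorus.ofTorusSite x) 0) *
      annihilation (orb (FermionTorus.ofTorusSite (x + Torus.proj L e)) 1)) *ᵥ Pi.single s₀ (1 : ℂ) = 0 := by
    convert hcf_annihilation_mul_annihilation_mulVec_single_eq_zero _ _ _ (h x e he).1 using 3
  have h2 : (annihilation (orb (FermionTorus.ofTorusSite x) 1) *
      annihilation (orb (FermionTorus.ofTorusSite (x + Torus.proj L e)) 0)) *ᵥ Pi.single s₀ (1 : ℂ) = 0 := by
    convert hcf_annihilation_mul_annihilation_mulVec_single_eq_zero _ _ _ (h x e he).2 using 3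
  rw [h1, h2, sub_zero, smul_zero]

omit [NeZero L] in
/-- The `↑↓` occupation pattern `pairSet A B` (`A↑ ∪ B↓`) seen from an orbital `(y, σ)`. [folklore] -/
theorem hcf_orb_mem_pairSet_iff (A B : Finset (FermionTorus 2 L)) (y : FermionTorus 2 L) (σ : Fin 2) :
    orb y σ ∈ pairSet A B ↔ (σ = 0 ∧ y ∈ A) ∨ (σ = 1 ∧ y ∈ B) := by
  rw [mem_pairSet]
  simp [orb]

omit [NeZero L] in
/-- The `↑↓` pattern state `|A↑ B↓⟩` lies in the joint sector `(N, S^z) = (2m, 0)` when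
`|A| = |B| = m`. [folklore] -/
theorem hcf_single_pairSet_mem_szSector (A B : Finset (FermionTorus 2 L)) {m : ℕ} (hA : A.card = m)
    (hB : B.card = m) :
    (Pi.single (pairSet A B) (1 : ℂ) : Fock (Orb (FermionTorus 2 L))) ∈
      szSector (Λ := FermionTorus 2 L) (2 * m) 0 := by
  rw [mem_szSector_two_mul_zero_iff]
  intro s hs
  by_cases hs0 : s = pairSet A B
  · subst hs0
    exact absurd ⟨by rw [upPart_pairSet, hA], by rw [downPart_pairSet, hB]⟩ hs
  · exact Pi.single_eq_of_ne hs0 _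

/-! ### The row-separated configuration -/

omit [NeZero L] in
/-- The rank `x₀ + L x₁ ∈ [0, L²)` of a torus site (`finFunctionFinEquiv`). [folklore] -/
theorem hcf_rank_val (x : FermionTorus 2 L) :
    ((finFunctionFinEquiv (ofLex x) : Fin (L ^ 2)) : ℕ) = (ofLex x 0 : ℕ) + L * (ofLex x 1 : ℕ) := by
  rw [finFunctionFinEquiv_apply, Fin.sum_univ_two]
  simp
  ring

/-- Rank of a site given by torus coordinates. [folklore] -/
theorem hcf_rank_ofTorusSite (x : TorusSite 2 L) :
    ((finFunctionFinEquiv (ofLex (FermionTorus.ofTorusSite x)) : Fin (L ^ 2)) : ℕ) =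
      (x 0).val + L * (x 1).val := by
  rw [hcf_rank_val]
  rfl

/-- One lattice step changes the rank by at most `L`, as long as both sites avoid the last row
(`rank < L² - L`, so no wrap-around in the slow coordinate). [folklore] -/
theorem hcf_rank_step_le (hL : 2 ≤ L) (u : TorusSite 2 L) (i : Fin 2)
    (hu : (u 0).val + L * (u 1).val < L ^ 2 - L)
    (hv : ((u + (Pi.single i 1 : TorusSite 2 L)) 0).val + L * ((u + (Pi.single i 1 : TorusSite 2 L)) 1).val < L ^ 2 - L) :
    (((u + (Pi.single i 1 : TorusSite 2 L)) 0).val + L * ((u + (Pi.single i 1 : TorusSite 2 L)) 1).val : ℤ) -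
        ((u 0).val + L * (u 1).val : ℤ) ≤ L ∧
      ((u 0).val + L * (u 1).val : ℤ) -
        (((u + (Pi.single i 1 : TorusSite 2 L)) 0).val + L * ((u + (Pi.single i 1 : TorusSite 2 L)) 1).val : ℤ) ≤ L := by
  haveI : Fact (1 < L) := ⟨hL⟩
  have hval1 : ∀ a : ZMod L, (a + 1).val = (a.val + 1) % L := fun a => by
    rw [ZMod.val_add, ZMod.val_one]
  have hlt : ∀ a : ZMod L, a.val < L := fun a => ZMod.val_lt a
  have hi : i = 0 ∨ i = 1 := by fin_cases i <;> simp
  rcases hi with rfl | rfl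
  · -- step in the fast coordinate: rank changes by `+1` or `-(L-1)`
    have h0 : (u + (Pi.single (0 : Fin 2) 1 : TorusSite 2 L)) 0 = u 0 + 1 := by simp
    have h1 : (u + (Pi.single (0 : Fin 2) 1 : TorusSite 2 L)) 1 = u 1 := by simp
    rw [h0, h1] at hv ⊢
    rw [hval1] at hv ⊢
    have hu0 := hlt (u 0)
    by_cases hw : (u 0).val + 1 < L
    · rw [Nat.mod_eq_of_lt hw]
      push_cast
      constructor <;> linarith
    · have heq : (u 0).val + 1 = L := by omega
      rw [heq, Nat.mod_self]
      push_cast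
      constructor <;> nlinarith
  · -- step in the slow coordinate: rank changes by `+L` (no wrap by the row hypothesis)
    have h0 : (u + (Pi.single (1 : Fin 2) 1 : TorusSite 2 L)) 0 = u 0 := by simp
    have h1 : (u + (Pi.single (1 : Fin 2) 1 : TorusSite 2 L)) 1 = u 1 + 1 := by simp
    rw [h0, h1] at hv ⊢
    rw [hval1] at hv ⊢
    have hu1 := hlt (u 1)
    by_cases hw : (u 1).val + 1 < L
    · rw [Nat.mod_eq_of_lt hw]
      push_cast
      constructor <;> nlinarith
    · -- `u` would sit in the last row, contradicting `hu`
      exfalso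
      have heq : (u 1).val = L - 1 := by omega
      rw [heq] at hu
      have : L * (L - 1) = L ^ 2 - L := by
        rw [Nat.mul_sub_one, sq]
      omega

omit [NeZero L] in
/-- `proj (single i 1) = single i 1` on the torus. [folklore] -/
theorem hcf_proj_single (i : Fin 2) : Torus.proj L (Pi.single i 1 : Site 2) = Pi.single i 1 := by
  funext j
  by_cases hj : j = i
  · subst hj; simp [Torus.proj]
  · simp [Torus.proj, Pi.single_eq_of_ne hj]

omit [NeZero L] in
/-- `proj (-v) = -proj v`. [folklore] -/
theorem hcf_proj_neg (v : Site 2) : Torus.proj L (-v) = -Torus.proj L v := by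
  funext j; simp [Torus.proj]

/-- **Row separation forbids `↑↓` neighbours.** With sites ranked by `x₀ + L x₁`, if the `↑` sites have
rank `< m` and the `↓` sites rank in `[m + 2L, 2m + 2L)` with `2m + 3L ≤ L²`, then no lattice step
(or the zero step) joins an `↑` site to a `↓` site. [folklore] -/
theorem hcf_rowSeparated_no_neighbours (hL : 2 ≤ L) {m : ℕ} (hm : 2 * m + 3 * L ≤ L ^ 2)
    (x : TorusSite 2 L) (e : Site 2) (he : e ∈ insert (0 : Site 2) unitSteps)
    (P Q : TorusSite 2 L → Prop)
    (hP : ∀ y, P y ↔ (y 0).val + L * (y 1).val < m)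
    (hQ : ∀ y, Q y ↔ m + 2 * L ≤ (y 0).val + L * (y 1).val ∧ (y 0).val + L * (y 1).val < 2 * m + 2 * L) :
    ¬ (P x ∧ Q (x + Torus.proj L e)) ∧ ¬ (Q x ∧ P (x + Torus.proj L e)) := by
  -- a step changes the rank by at most `L`, but `P`- and `Q`-ranks differ by more than `2L`
  have key : ∀ (u : TorusSite 2 L) (i : Fin 2),
      ¬ (P u ∧ Q (u + (Pi.single i 1 : TorusSite 2 L))) ∧ ¬ (Q u ∧ P (u + (Pi.single i 1 : TorusSite 2 L))) ∧
      ¬ (P (u + (Pi.single i 1 : TorusSite 2 L)) ∧ Q u) ∧ ¬ (Q (u + (Pi.single i 1 : TorusSite 2 L)) ∧ P u) := by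
    intro u i
    have hstep := hcf_rank_step_le L hL u i
    refine ⟨fun ⟨hu, hv⟩ => ?_, fun ⟨hu, hv⟩ => ?_, fun ⟨hv, hu⟩ => ?_, fun ⟨hv, hu⟩ => ?_⟩
    · rw [hP] at hu; rw [hQ] at hv
      have h := (hstep (by omega) (by omega)).1
      omega
    · rw [hQ] at hu; rw [hP] at hv
      have h := (hstep (by omega) (by omega)).2
      omega
    · rw [hP] at hv; rw [hQ] at hu
      have h := (hstep (by omega) (by omega)).2
      omega
    · rw [hQ] at hv; rw [hP] at hu
      have h := (hstep (by omega) (by omega)).1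
      omega
  simp only [unitSteps, mem_insert, mem_singleton] at he
  rcases he with rfl | rfl | rfl | rfl | rfl
  · -- `e = 0`
    have h0 : Torus.proj L (0 : Site 2) = 0 := funext fun j => by simp [Torus.proj]
    rw [h0, add_zero]
    constructor
    · rintro ⟨hp, hq⟩; rw [hP] at hp; rw [hQ] at hq; omega
    · rintro ⟨hq, hp⟩; rw [hP] at hp; rw [hQ] at hq; omega
  · rw [hcf_proj_single]
    exact ⟨(key x 0).1, (key x 0).2.1⟩
  · rw [hcf_proj_neg, hcf_proj_single]
    have h := key (x + -(Pi.single 0 1 : TorusSite 2 L)) 0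
    rw [neg_add_cancel_right] at h
    exact ⟨h.2.2.1, h.2.2.2⟩
  · rw [hcf_proj_single]
    exact ⟨(key x 1).1, (key x 1).2.1⟩
  · rw [hcf_proj_neg, hcf_proj_single]
    have h := key (x + -(Pi.single 1 1 : TorusSite 2 L)) 1
    rw [neg_add_cancel_right] at h
    exact ⟨h.2.2.1, h.2.2.2⟩

omit [NeZero L] in
/-- Counting sites by rank: `#{x : rank x < k} = min (L²) k`. [folklore] -/
theorem hcf_card_filter_rank_lt (k : ℕ) :
    (univ.filter fun x : FermionTorus 2 L =>
        ((finFunctionFinEquiv (ofLex x) : Fin (L ^ 2)) : ℕ) < k).card = min (L ^ 2) k := by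
  have h := Fin.card_filter_val_lt (n := L ^ 2) (m := k)
  rw [← h]
  refine card_bij (fun x _ => finFunctionFinEquiv (ofLex x)) (fun x hx => ?_) (fun x _ y _ hxy => ?_)
    (fun j hj => ?_)
  · simpa using hx
  · exact toLex.symm.injective (finFunctionFinEquiv.injective hxy)
  · refine ⟨toLex (finFunctionFinEquiv.symm j), ?_, ?_⟩
    · simp only [mem_filter, mem_univ, true_and] at hj ⊢
      rw [ofLex_toLex, Equiv.apply_symm_apply]
      exact hj
    · rw [ofLex_toLex, Equiv.apply_symm_apply]

/-- **Explicit unit kernel states**: for `2 ≤ L`, `2m + 3L ≤ L²`, there is a unit vector of the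
joint sector `(N, S^z) = (2m, 0)` annihilated by the `d`-wave pair field (the `↑↓` pattern state of
two row-separated blocks of `m` sites). [folklore] -/
theorem hcf_exists_unit_kernel_state (hL : 2 ≤ L) {m : ℕ} (hm : 2 * m + 3 * L ≤ L ^ 2) :
    ∃ φ : Fock (Orb (FermionTorus 2 L)), φ ∈ szSector (Λ := FermionTorus 2 L) (2 * m) 0 ∧
      star φ ⬝ᵥ φ = 1 ∧ pairField dWaveFormFactor L *ᵥ φ = 0 := by
  set rank : FermionTorus 2 L → ℕ := fun x => ((finFunctionFinEquiv (ofLex x) : Fin (L ^ 2)) : ℕ)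
    with hrank
  set A : Finset (FermionTorus 2 L) := univ.filter fun x => rank x < m with hA_def
  set B : Finset (FermionTorus 2 L) :=
    (univ.filter fun x => rank x < 2 * m + 2 * L) \ (univ.filter fun x => rank x < m + 2 * L) with hB_def
  have hAcard : A.card = m := by
    rw [hA_def, hcf_card_filter_rank_lt]
    exact min_eq_right (by omega)
  have hBcard : B.card = m := by
    rw [hB_def, card_sdiff_of_subset (fun x hx => by
      simp only [mem_filter, mem_univ, true_and] at hx ⊢; omega),
      hcf_card_filter_rank_lt, hcf_card_filter_rank_lt, min_eq_right (by omega), min_eq_right (by omega)]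
    omega
  have hmemB : ∀ y, y ∈ B ↔ m + 2 * L ≤ rank y ∧ rank y < 2 * m + 2 * L := fun y => by
    simp only [hB_def, mem_sdiff, mem_filter, mem_univ, true_and, not_lt]
    tauto
  refine ⟨Pi.single (pairSet A B) 1, hcf_single_pairSet_mem_szSector L A B hAcard hBcard, by simp, ?_⟩
  refine hcf_pairField_mulVec_single_eq_zero L dWaveFormFactor (pairSet A B) fun x e he => ?_
  have hPA : ∀ y : TorusSite 2 L, FermionTorus.ofTorusSite y ∈ A ↔ (y 0).val + L * (y 1).val < m := by
    intro y
    simp only [hA_def, mem_filter, mem_univ, true_and, hrank]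
    rw [hcf_rank_ofTorusSite]
  have hQB : ∀ y : TorusSite 2 L, FermionTorus.ofTorusSite y ∈ B ↔
      m + 2 * L ≤ (y 0).val + L * (y 1).val ∧ (y 0).val + L * (y 1).val < 2 * m + 2 * L := by
    intro y
    rw [hmemB]
    simp only [hrank]
    rw [hcf_rank_ofTorusSite]
  have hsep := hcf_rowSeparated_no_neighbours L hL hm x e he
    (fun y => FermionTorus.ofTorusSite y ∈ A) (fun y => FermionTorus.ofTorusSite y ∈ B) hPA hQB
  rw [hcf_orb_mem_pairSet_iff, hcf_orb_mem_pairSet_iff, hcf_orb_mem_pairSet_iff, hcf_orb_mem_pairSet_iff]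
  simp only [Fin.isValue, true_and, zero_ne_one, one_ne_zero, false_and, or_false, false_or]
  exact hsep

end Torus

/-! ### The `minEnergyOn` normal form of the crux -/

/-- **The condensate-poor part of the sector contains a unit vector** (for `3 ≤ δ L`, `δ ≤ 1`,
`2 ≤ L`): a unit kernel state of `Δ` in `szSector N_L 0` lies in `ker Π_L ⊆ ⊕_{μ ≤ a} ker(Π_L - μ)`
for every `a ≥ 0`. [folklore] -/
theorem hcf_exists_unit_mem_szSector_inf_condPoor (L : ℕ) [NeZero L] (hL : 2 ≤ L) {δ : ℝ}
    (hδ1 : δ ≤ 1) (hδL : 3 ≤ δ * L) {a : ℝ} (ha : 0 ≤ a) :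
    ∃ φ ∈ szSector (Λ := FermionTorus 2 L) (2 * ⌊(1 - δ) * (L : ℝ) ^ 2 / 2⌋₊) 0 ⊓
      (⨆ (μ : ℝ) (_ : μ ≤ a), Module.End.eigenspace
        (Matrix.toLin' (((1 : ℂ) / ((L : ℂ) ^ 4)) •
          ((pairField dWaveFormFactor L)ᴴ * pairField dWaveFormFactor L))) (μ : ℂ)),
      star φ ⬝ᵥ φ = 1 := by
  set m : ℕ := ⌊(1 - δ) * (L : ℝ) ^ 2 / 2⌋₊ with hm
  have hmle : 2 * m + 3 * L ≤ L ^ 2 := by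
    have h1 : (m : ℝ) ≤ (1 - δ) * (L : ℝ) ^ 2 / 2 := by
      rw [hm]
      refine Nat.floor_le ?_
      have : 0 ≤ 1 - δ := by linarith
      positivity
    have h2 : (2 * m + 3 * L : ℝ) ≤ (L : ℝ) ^ 2 := by nlinarith
    exact_mod_cast h2
  obtain ⟨φ, hφS, hφ1, hφ0⟩ := hcf_exists_unit_kernel_state L hL hmle
  refine ⟨φ, Submodule.mem_inf.2 ⟨hφS, ?_⟩, hφ1⟩
  refine Submodule.mem_iSup_of_mem 0 (Submodule.mem_iSup_of_mem ha ?_)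
  rw [Module.End.mem_eigenspace_iff, Matrix.toLin'_apply, Complex.ofReal_zero, zero_smul,
    smul_mulVec, ← mulVec_mulVec, hφ0, mulVec_zero, smul_zero]

/-- **The crux in the Sketch's `minEnergyOn` form** (`CompressionGapAt` with `condPoor`, card
`heavy-condensate-fibration`): `LowEnergyRigidity` holds iff for some `U > 0`, `δ ∈ (0,½)`, `a > 0`,
`κ > 0` and all large even `L`,
`minEnergyOn H_L S_L + κ ≤ minEnergyOn H_L (S_L ⊓ ⊕_{μ ≤ a} ker(Π_L - μ))` —
the compression of the Hubbard Hamiltonian to the KINEMATIC condensate-poor subspace of the sector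
is gapped above the sector ground energy. (`→`: the vector form `hcf_condPoorGap_of_lowEnergyRigidity`
plus non-emptiness `hcf_exists_unit_mem_szSector_inf_condPoor`; `←`:
`hcf_lowEnergyRigidity_of_condPoorGap` with `a ↦ a/2`.) [folklore] -/
theorem hcf_compressionGapAt_iff_lowEnergyRigidity :
    LowEnergyRigidity ↔
      ∃ U : ℝ, 0 < U ∧ ∃ δ ∈ Set.Ioo (0 : ℝ) (1 / 2), ∃ a : ℝ, 0 < a ∧ ∃ κ : ℝ, 0 < κ ∧ ∃ L₀ : ℕ,
        ∀ (L : ℕ) [NeZero L], L₀ ≤ L → Even L →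
          (hubbardTorus 2 L 1 U).minEnergyOn (szSector (2 * ⌊(1 - δ) * (L : ℝ) ^ 2 / 2⌋₊) 0) + κ ≤
            (hubbardTorus 2 L 1 U).minEnergyOn (szSector (2 * ⌊(1 - δ) * (L : ℝ) ^ 2 / 2⌋₊) 0 ⊓
              ⨆ (μ : ℝ) (_ : μ ≤ a), Module.End.eigenspace
                (Matrix.toLin' (((1 : ℂ) / ((L : ℂ) ^ 4)) •
                  ((pairField dWaveFormFactor L)ᴴ * pairField dWaveFormFactor L))) (μ : ℂ)) := by
  constructor
  · intro h
    obtain ⟨U, hU, δ, hδ, a, ha, κ, hκ, L₀, hgap⟩ := hcf_condPoorGap_of_lowEnergyRigidity h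
    -- also make `L` large enough for the explicit kernel state: `L ≥ 3/δ` and `L ≥ 2`
    set L₁ : ℕ := ⌈3 / δ⌉₊ + 2 with hL₁
    refine ⟨U, hU, δ, hδ, a, ha, κ, hκ, max L₀ L₁, fun L _ hL hev => ?_⟩
    have hL0 : L₀ ≤ L := le_of_max_le_left hL
    have hL1 : L₁ ≤ L := le_of_max_le_right hL
    have hL2 : 2 ≤ L := by omega
    have hδL : 3 ≤ δ * L := by
      have h1 : 3 / δ ≤ (L₁ : ℝ) := by
        rw [hL₁]; push_cast; linarith [Nat.le_ceil (3 / δ)]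
      have h2 : (L₁ : ℝ) ≤ L := by exact_mod_cast hL1
      have h3 : 3 / δ ≤ (L : ℝ) := h1.trans h2
      rw [div_le_iff₀ hδ.1] at h3
      linarith [mul_comm (L : ℝ) δ]
    obtain ⟨φ₀, hφ₀, hφ₀1⟩ := hcf_exists_unit_mem_szSector_inf_condPoor L hL2 (by linarith [hδ.2]) hδL ha.le
    refine le_csInf ⟨_, φ₀, hφ₀, hφ₀1, rfl⟩ ?_
    rintro E ⟨φ, hφ, hφ1, rfl⟩
    obtain ⟨hφS, hφT⟩ := Submodule.mem_inf.1 hφ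
    have h1 := hgap L hL0 hev φ hφS hφT
    rw [hφ1, Complex.one_re, mul_one] at h1
    exact h1
  · rintro ⟨U, hU, δ, hδ, a, ha, κ, hκ, L₀, h⟩
    refine hcf_lowEnergyRigidity_of_condPoorGap ⟨U, hU, δ, hδ, a / 2, by positivity, κ, hκ, L₀, ?_⟩
    intro L _ hL hev
    have ha2 : 2 * (a / 2) = a := by ring
    rw [ha2]
    exact h L hL hev

end Summit.HubbardSuperconductivity.HubbardSuperconductivity.Theorems
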